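import Literature.Topology.FourManifolds.BordismFour
import Literature.Topology.FourManifolds.BordismFourSignature
import Literature.Topology.FourManifolds.IntersectionLatticeProofs
import Literature.Topology.FourManifolds.ComplexProjectiveSpaceProofs
import Literature.AlgebraicTopology.SingularHomology.ContractiblePunctured
import Literature.AlgebraicTopology.SingularHomology.OrientationCover
import Literature.AlgebraicTopology.SingularHomology.CupProductProofs
import Literature.AlgebraicTopology.SingularHomology.CohomologyFiniteness
import Literature.AlgebraicTopology.SingularHomology.CompactManifoldFiniteness
import Literature.AlgebraicTopology.SingularHomology.UniversalCoefficientsFree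
import Literature.AlgebraicTopology.SingularHomology.UniversalCoefficientsProofs
import Literature.AlgebraicTopology.SingularHomology.SimplyConnectedH1
import Literature.AlgebraicTopology.SingularHomology.PoincareDualityProofs
import Literature.AlgebraicTopology.SingularHomology.SphereHomology
import Literature.AlgebraicTopology.SingularHomology.ExcisionMayerVietorisProofs
import Mathlib.Topology.Maps.OpenQuotient
import Mathlib.Topology.LocalAtTarget
import Mathlib.Topology.Homotopy.Equiv
import HarnessLib

/-!
# The signature of the complex projective plane (towards `exists_signature_complexProjectivePlane_eq_one`)

Sibling proof file of `Literature.Topology.FourManifolds.BordismFour`, for the spc4.S36 fact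
`Literature.Topology.FourManifolds.exists_signature_complexProjectivePlane_eq_one`
(`∃ μ : HomologicalOrientation ℤ ℂℙ² 4, μ.signature = 1`; Thom, *Quelques propriétés globales des
variétés différentiables*, Comment. Math. Helv. 28 (1954), Thm IV.13: `Ω⁴ ≅ ℤ`, "Le générateur de
`Ω⁴` est représenté par le plan projectif complexe `PC(2)`", and p. 82: "pour `PC(2)`, pour lequel
`τ = 1`"; Milnor–Stasheff, *Characteristic Classes* (1974), Thm. 14.10).

Thom takes `τ(PC(2)) = 1` as known; the computation behind it is `H²(ℂP²; ℤ) ≅ ℤ` generated by a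
class `a` with `⟨a ⌣ a, [ℂP²]⟩ = ±1` (Poincaré duality).  This file PROVES, from the tree:

* `ComplexProjectiveSpace.homotopyEquivComplCenter` — **`ℂℙⁿ⁺¹` minus the coordinate point
  `center i = [0 : ⋯ : 1 : ⋯ : 0]` is homotopy equivalent to `ℂℙⁿ`**: the projection from the
  centre onto the hyperplane `{zᵢ = 0} ≅ ℂℙⁿ` (`dropAtMap`, `hyperplaneEmbMap`) and the straight-line
  homotopy `(t, [v]) ↦ [⋯ : t vᵢ : ⋯]` (`scaleHomotopy`), continuity being checked through the open
  quotient map `ℂⁿ⁺² ∖ {0} → ℂℙⁿ⁺¹` (Hatcher, *Algebraic Topology* (2002), Example 0.6: the cell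
  structure `ℂPⁿ⁺¹ = ℂPⁿ ∪ e²ⁿ⁺²`);
* `mayerVietoris.isIso_map_subsetIncl_of_isZero` — a Mayer–Vietoris isomorphism criterion
  (Hatcher 2002, §2.2 p. 149), from the proved exactness `mayerVietoris.exact₁_holds`/`exact₂_holds`;
* `ComplexProjectivePlane.singularHomologyTwoIso` — **`H₂(ℂℙ²; M) ≅ M`** for every coefficient
  module (Hatcher 2002, §2.2 p. 140: `Hᵢ(ℂPⁿ) ≅ ℤ` for `i` even `≤ 2n`): Mayer–Vietoris for the cover
  of `ℂℙ²` by the affine chart `{z₂ ≠ 0} ≅ ℝ⁴` and the punctured plane `ℂℙ² ∖ {[0:0:1]} ≃ ℂℙ¹`,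
  whose intersection is `ℝ⁴ ∖ {0} ≃ S³` (`ContractiblePunctured.lean`, `SphereHomology.lean`), and
  `ℂℙ¹ ≅ S²` (`nonempty_diffeomorph_complexProjectiveSpace_one_sphere_holds`);
* `ComplexProjectivePlane.freeCohomologyTwoLinearEquivInt`, `finrank_freeCohomology_two` —
  **`H²(ℂℙ²; ℤ)/T ≅ ℤ`, `b₂(ℂℙ²) = 1`**, by universal coefficients (`kroneckerPairing_bijective_of_isZero`,
  `torsion_singularCohomology_eq_bot_of_isZero`, Hatcher Thm. 3.2 / Cor. 3.3) and `H₁(ℂℙ²) = 0`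
  (`ℂℙ²` simply connected, `simplyConnectedSpace_complexProjectivePlane_holds`, Hatcher Thm. 2A.1);
* `exists_signature_complexProjectivePlane_eq_one_of_poincareDuality` — **the fact, given Poincaré
  duality for `ℂℙ²`** (the tree's named fact `bijective_poincareDualityMap`, Hatcher Thm. 3.30, as the
  hypothesis `hD`): a `ℤ`-orientation exists (`isOrientableOver_int_of_simplyConnectedSpace_holds`),
  the cup form on the rank-one lattice `H²(ℂℙ²; ℤ)/T` is unimodular
  (`isPerfPair_cupPairingModTorsion_of_poincareDuality`) and symmetric, so `b₂⁺ + b₂⁻ = 1`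
  (`sigPos_add_sigNeg_intersectionForm_of_isPerfPair`), `σ = ±1`, and `σ(-μ) = -σ(μ)`
  (`HomologicalOrientation.signature_neg_holds`).

* `exists_signature_complexProjectivePlane_eq_one_holds` — **the discharge**, feeding
  `…_of_poincareDuality` the tree's proof of Poincaré duality `poincare_duality`
  (`PoincareDualityProofs.lean`, Hatcher Thm. 3.30 via Miller's Čech duality Thm. 37.1).

No named fact is introduced here.

## References

* R. Thom, *Quelques propriétés globales des variétés différentiables*, Comment. Math. Helv. 28
  (1954), Thm IV.13 and p. 82. [ThomCMH1954]
* A. Hatcher, *Algebraic Topology*, CUP 2002, Example 0.6; §2.2 pp. 140, 149; Cor. 2.14; Thm. 2A.1;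
  §3.1 Thm. 3.2, Cor. 3.3; §3.3 Thm. 3.30, Prop. 3.38. [HatcherAT2002]
* J. Milnor, J. Stasheff, *Characteristic Classes*, Princeton 1974, §14, Thm. 14.10. [MilnorStasheffAMS76]
-/

open scoped Topology
open Set Function Topology

set_option autoImplicit false

noncomputable section

namespace Literature.Topology.FourManifolds

namespace ComplexProjectiveSpace

variable {n : ℕ}

/-! ### The hyperplane `{z_i = 0} ≅ ℂℙⁿ` in `ℂℙⁿ⁺¹` and the point `[0 : ⋯ : 1 : ⋯ : 0]` -/

/-- A nonzero vector of `ℂⁿ⁺¹` padded with a zero in slot `i` is a nonzero vector of `ℂⁿ⁺²`. [folklore] -/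
def padAt (i : Fin (n + 1 + 1)) (w : {w : Fin (n + 1) → ℂ // w ≠ 0}) :
    {v : Fin (n + 1 + 1) → ℂ // v ≠ 0} :=
  ⟨Fin.insertNth i 0 (w : Fin (n + 1) → ℂ), fun h ↦ w.2 (by
    funext j
    have := congr_fun h (i.succAbove j)
    simpa only [Fin.insertNth_apply_succAbove, Pi.zero_apply] using this)⟩

/-- The underlying vector of `padAt i w` is `w` with a zero inserted in slot `i`. [folklore] -/
@[simp] theorem coe_padAt (i : Fin (n + 1 + 1)) (w : {w : Fin (n + 1) → ℂ // w ≠ 0}) :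
    (padAt i w : Fin (n + 1 + 1) → ℂ) = Fin.insertNth i 0 (w : Fin (n + 1) → ℂ) := rfl

/-- Scalar multiplication commutes with inserting a zero coordinate. [folklore] -/
theorem smul_insertNth_zero (i : Fin (n + 1 + 1)) (t : ℂ) (w : Fin (n + 1) → ℂ) :
    t • Fin.insertNth i (0 : ℂ) w = Fin.insertNth i (0 : ℂ) (t • w) := by
  symm
  refine Fin.insertNth_eq_iff.2 ⟨by simp, ?_⟩
  funext j
  simp [Fin.removeNth]

/-- The linear embedding `ℂℙⁿ ↪ ℂℙⁿ⁺¹` onto the hyperplane `{z_i = 0}`, `[w] ↦ [w₀ : ⋯ : 0 : ⋯ : w_n]`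
(zero inserted in slot `i`) (Milnor–Stasheff, *Characteristic Classes*, §14, `ℂPⁿ ⊂ ℂPⁿ⁺¹`). [folklore] -/
def hyperplaneEmb (i : Fin (n + 1 + 1)) : ComplexProjectiveSpace n → ComplexProjectiveSpace (n + 1) :=
  Projectivization.lift (fun w ↦ mk (padAt i w)) (by
    rintro a b t h
    refine (mk_eq_mk_iff _ _).2 ⟨t, ?_⟩
    rw [coe_padAt, coe_padAt, smul_insertNth_zero, ← h])

/-- `hyperplaneEmb i [w] = [w with 0 inserted in slot i]`. [folklore] -/
@[simp] theorem hyperplaneEmb_mk (i : Fin (n + 1 + 1)) (w : {w : Fin (n + 1) → ℂ // w ≠ 0}) :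
    hyperplaneEmb i (mk w) = mk (padAt i w) := rfl

/-- Padding with a zero coordinate is continuous. [folklore] -/
theorem continuous_padAt (i : Fin (n + 1 + 1)) : Continuous (padAt (n := n) i) :=
  have : Continuous fun w : Fin (n + 1) → ℂ ↦ (Fin.insertNth i (0 : ℂ) w : Fin (n + 1 + 1) → ℂ) := by
    fun_prop
  (this.comp continuous_subtype_val).subtype_mk _

/-- The hyperplane embedding `ℂℙⁿ ↪ ℂℙⁿ⁺¹` is continuous (it lifts the continuous padding map
through the quotient map `mk`). [folklore] -/
theorem continuous_hyperplaneEmb (i : Fin (n + 1 + 1)) : Continuous (hyperplaneEmb (n := n) i) := by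
  rw [isQuotientMap_mk.continuous_iff]
  exact continuous_mk.comp (continuous_padAt i)

/-- The coordinate point `[0 : ⋯ : 1 : ⋯ : 0]` (one in slot `i`), the centre of the `i`-th affine chart. [folklore] -/
def center (i : Fin (n + 1 + 1)) : ComplexProjectiveSpace (n + 1) :=
  mk (homogenize i 0)

/-- The `i`-th affine chart is centred at `center i`: its inverse sends `0` to `[0 : ⋯ : 1 : ⋯ : 0]`. [folklore] -/
theorem affineChart_symm_zero (i : Fin (n + 1 + 1)) : (affineChart i).symm 0 = center i := by
  rw [affineChart_symm_apply, map_zero]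
  rfl

/-- The predicate "`[v]` is not the coordinate point `center i`", i.e. `v` has a nonzero coordinate
off slot `i`; well defined on `ℂℙⁿ⁺¹`. [folklore] -/
def OffCenter (i : Fin (n + 1 + 1)) : ComplexProjectiveSpace (n + 1) → Prop :=
  Projectivization.lift (fun v ↦ Fin.removeNth i (v : Fin (n + 1 + 1) → ℂ) ≠ 0) (by
    rintro a b t h
    have ht : t ≠ 0 := by rintro rfl; exact a.2 (by simpa using h)
    have hab : Fin.removeNth i (a : Fin (n + 1 + 1) → ℂ) = t • Fin.removeNth i (b : Fin (n + 1 + 1) → ℂ) := by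
      funext j; simp [Fin.removeNth, h]
    simp [hab, ht])

/-- `OffCenter i [v]` unfolds to `(v_j)_{j ≠ i} ≠ 0`. [folklore] -/
@[simp] theorem offCenter_mk (i : Fin (n + 1 + 1)) (v : {v : Fin (n + 1 + 1) → ℂ // v ≠ 0}) :
    OffCenter i (mk v) ↔ Fin.removeNth i (v : Fin (n + 1 + 1) → ℂ) ≠ 0 := Iff.rfl

/-- The centre `homogenize i 0 = (0, …, 1, …, 0)` has no nonzero coordinate off slot `i`. [folklore] -/
theorem removeNth_homogenize_zero (i : Fin (n + 1 + 1)) :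
    Fin.removeNth i (homogenize i (0 : Fin (n + 1) → ℂ) : Fin (n + 1 + 1) → ℂ) = 0 := by
  funext j
  simp [homogenize, Fin.removeNth]

/-- `[v]` has a nonzero coordinate off slot `i` iff `[v]` is not the coordinate point `center i`. [folklore] -/
theorem offCenter_iff_ne_center (i : Fin (n + 1 + 1)) (p : ComplexProjectiveSpace (n + 1)) :
    OffCenter i p ↔ p ≠ center i := by
  induction p using ind with
  | h v =>
    rw [offCenter_mk, center, Ne, Ne, mk_eq_mk_iff, not_iff_not]
    constructor
    · intro h0
      refine ⟨(v : Fin (n + 1 + 1) → ℂ) i, ?_⟩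
      have hv : Fin.insertNth i ((v : Fin (n + 1 + 1) → ℂ) i) (0 : Fin (n + 1) → ℂ) =
          (v : Fin (n + 1 + 1) → ℂ) := by
        rw [← h0]
        exact Fin.insertNth_self_removeNth i _
      rw [← hv]
      symm
      refine Fin.insertNth_eq_iff.2 ⟨?_, ?_⟩
      · simp [homogenize]
      · funext j
        simp [homogenize, Fin.removeNth]
    · rintro ⟨a, ha⟩
      rw [← ha]
      funext j
      simp [homogenize, Fin.removeNth]

/-- Membership in the punctured projective space `ℂℙⁿ⁺¹ ∖ {center i}` is the predicate `OffCenter i`. [folklore] -/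
theorem mem_compl_center_iff (i : Fin (n + 1 + 1)) (p : ComplexProjectiveSpace (n + 1)) :
    p ∈ ({center i}ᶜ : Set (ComplexProjectiveSpace (n + 1))) ↔ OffCenter i p := by
  rw [mem_compl_iff, mem_singleton_iff, offCenter_iff_ne_center]

/-! ### The projection from the centre onto the hyperplane -/

/-- The projection `ℂℙⁿ⁺¹ ∖ {center i} → ℂℙⁿ` from the coordinate point, `[v] ↦ [v with slot i removed]`
(junk value `[1 : ⋯ : 1]` at the centre). [folklore] -/
def dropAt (i : Fin (n + 1 + 1)) : ComplexProjectiveSpace (n + 1) → ComplexProjectiveSpace n :=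
  Projectivization.lift
    (fun v ↦ if h : Fin.removeNth i (v : Fin (n + 1 + 1) → ℂ) = 0 then mk ⟨fun _ ↦ 1, by simp [funext_iff]⟩
      else mk ⟨Fin.removeNth i (v : Fin (n + 1 + 1) → ℂ), h⟩)
    (by
      rintro a b t h
      have ht : t ≠ 0 := by rintro rfl; exact a.2 (by simpa using h)
      have hab : Fin.removeNth i (a : Fin (n + 1 + 1) → ℂ) = t • Fin.removeNth i (b : Fin (n + 1 + 1) → ℂ) := by
        funext j; simp [Fin.removeNth, h]
      by_cases hb : Fin.removeNth i (b : Fin (n + 1 + 1) → ℂ) = 0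
      · have ha : Fin.removeNth i (a : Fin (n + 1 + 1) → ℂ) = 0 := by rw [hab, hb, smul_zero]
        simp only [ha, hb]
      · have ha : Fin.removeNth i (a : Fin (n + 1 + 1) → ℂ) ≠ 0 := by rw [hab]; exact smul_ne_zero ht hb
        rw [dif_neg ha, dif_neg hb]
        exact (mk_eq_mk_iff _ _).2 ⟨t, hab.symm⟩)

/-- `dropAt i [v] = [v with slot i removed]` off the centre. [folklore] -/
theorem dropAt_mk (i : Fin (n + 1 + 1)) (v : {v : Fin (n + 1 + 1) → ℂ // v ≠ 0})
    (h : Fin.removeNth i (v : Fin (n + 1 + 1) → ℂ) ≠ 0) :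
    dropAt i (mk v) = mk ⟨Fin.removeNth i (v : Fin (n + 1 + 1) → ℂ), h⟩ :=
  dif_neg h

/-- The projection from the centre is a left inverse of the hyperplane embedding. [folklore] -/
theorem dropAt_hyperplaneEmb (i : Fin (n + 1 + 1)) (q : ComplexProjectiveSpace n) :
    dropAt i (hyperplaneEmb i q) = q := by
  induction q using ind with
  | h w =>
    have h : Fin.removeNth i (padAt i w : Fin (n + 1 + 1) → ℂ) ≠ 0 := by
      simpa [coe_padAt] using w.2
    rw [hyperplaneEmb_mk, dropAt_mk i _ h]
    congr 1
    exact Subtype.ext (by simp)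

/-- The hyperplane `{z_i = 0}` misses the centre `center i`. [folklore] -/
theorem offCenter_hyperplaneEmb (i : Fin (n + 1 + 1)) (q : ComplexProjectiveSpace n) :
    OffCenter i (hyperplaneEmb i q) := by
  induction q using ind with
  | h w => simpa [coe_padAt] using w.2

/-- The projection from the centre is continuous on the punctured projective space (it lifts the
coordinate projection through the open quotient map `mk`). [folklore] -/
theorem continuousOn_dropAt (i : Fin (n + 1 + 1)) :
    ContinuousOn (dropAt (n := n) i) ({center i}ᶜ : Set (ComplexProjectiveSpace (n + 1))) := by
  refine continuousOn_of_comp_mk isOpen_compl_singleton ?_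
  rw [continuousOn_iff_continuous_restrict]
  have hmem : ∀ v : ↥(mk ⁻¹' ({center i}ᶜ : Set (ComplexProjectiveSpace (n + 1)))),
      Fin.removeNth i ((v : {v : Fin (n + 1 + 1) → ℂ // v ≠ 0}) : Fin (n + 1 + 1) → ℂ) ≠ 0 :=
    fun v ↦ (mem_compl_center_iff i _).1 v.2
  have heq : (mk ⁻¹' ({center i}ᶜ : Set (ComplexProjectiveSpace (n + 1)))).restrict (dropAt i ∘ mk) =
      fun v : ↥(mk ⁻¹' ({center i}ᶜ : Set (ComplexProjectiveSpace (n + 1)))) ↦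
        mk (n := n) ⟨Fin.removeNth i ((v : {v : Fin (n + 1 + 1) → ℂ // v ≠ 0}) : Fin (n + 1 + 1) → ℂ),
          hmem v⟩ :=
    funext fun v ↦ dropAt_mk i _ (hmem v)
  rw [heq]
  refine continuous_mk.comp (Continuous.subtype_mk ?_ _)
  exact continuous_pi fun j ↦ (continuous_apply _).comp
    (continuous_subtype_val.comp continuous_subtype_val)

/-- The projection from the centre as a continuous map on the punctured projective space
`{center i}ᶜ → ℂℙⁿ`. [folklore] -/
def dropAtMap (i : Fin (n + 1 + 1)) :
    C(↥({center i}ᶜ : Set (ComplexProjectiveSpace (n + 1))), ComplexProjectiveSpace n) where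
  toFun p := dropAt i p
  continuous_toFun := continuousOn_iff_continuous_restrict.1 (continuousOn_dropAt (n := n) i)

/-- The hyperplane embedding as a continuous map into the punctured projective space
`ℂℙⁿ → {center i}ᶜ`. [folklore] -/
def hyperplaneEmbMap (i : Fin (n + 1 + 1)) :
    C(ComplexProjectiveSpace n, ↥({center i}ᶜ : Set (ComplexProjectiveSpace (n + 1)))) where
  toFun q := ⟨hyperplaneEmb i q, (mem_compl_center_iff i _).2 (offCenter_hyperplaneEmb i q)⟩
  continuous_toFun := (continuous_hyperplaneEmb i).subtype_mk _

/-- `dropAtMap i ∘ hyperplaneEmbMap i = id`. [folklore] -/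
@[simp] theorem dropAtMap_hyperplaneEmbMap (i : Fin (n + 1 + 1)) (q : ComplexProjectiveSpace n) :
    dropAtMap i (hyperplaneEmbMap i q) = q :=
  dropAt_hyperplaneEmb i q

/-! ### The radial homotopy `[v] ↦ [v₀ : ⋯ : t vᵢ : ⋯ : vₙ₊₁]` -/

/-- Scaling the `i`-th homogeneous coordinate by `t`: `[v] ↦ [v with vᵢ replaced by t vᵢ]`
(junk value `[v]` where this vanishes, i.e. at the centre for `t = 0`). [folklore] -/
def scaleAt (i : Fin (n + 1 + 1)) (t : ℂ) : ComplexProjectiveSpace (n + 1) → ComplexProjectiveSpace (n + 1) :=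
  Projectivization.lift
    (fun v ↦ if h : update (v : Fin (n + 1 + 1) → ℂ) i (t * (v : Fin (n + 1 + 1) → ℂ) i) = 0 then mk v
      else mk ⟨_, h⟩)
    (by
      rintro a b s h
      have hs : s ≠ 0 := by rintro rfl; exact a.2 (by simpa using h)
      have hab : update (a : Fin (n + 1 + 1) → ℂ) i (t * (a : Fin (n + 1 + 1) → ℂ) i) =
          s • update (b : Fin (n + 1 + 1) → ℂ) i (t * (b : Fin (n + 1 + 1) → ℂ) i) := by
        funext j
        by_cases hj : j = i
        · subst hj; simp [h]; ring
        · simp [hj, h]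
      by_cases hb : update (b : Fin (n + 1 + 1) → ℂ) i (t * (b : Fin (n + 1 + 1) → ℂ) i) = 0
      · have ha : update (a : Fin (n + 1 + 1) → ℂ) i (t * (a : Fin (n + 1 + 1) → ℂ) i) = 0 := by
          rw [hab, hb, smul_zero]
        rw [dif_pos ha, dif_pos hb]
        exact (mk_eq_mk_iff _ _).2 ⟨s, h.symm⟩
      · have ha : update (a : Fin (n + 1 + 1) → ℂ) i (t * (a : Fin (n + 1 + 1) → ℂ) i) ≠ 0 := by
          rw [hab]; exact smul_ne_zero hs hb
        rw [dif_neg ha, dif_neg hb]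
        exact (mk_eq_mk_iff _ _).2 ⟨s, hab.symm⟩)

/-- Changing the `i`-th coordinate of a vector with a nonzero coordinate off slot `i` keeps it nonzero. [folklore] -/
theorem update_ne_zero_of_removeNth_ne_zero (i : Fin (n + 1 + 1)) (v : Fin (n + 1 + 1) → ℂ) (c : ℂ)
    (h : Fin.removeNth i v ≠ 0) : update v i c ≠ 0 := by
  intro h0
  apply h
  rw [← Fin.removeNth_update i c v, h0]
  rfl

/-- `scaleAt i t [v] = [v with vᵢ replaced by t vᵢ]` off the centre. [folklore] -/
theorem scaleAt_mk (i : Fin (n + 1 + 1)) (t : ℂ) (v : {v : Fin (n + 1 + 1) → ℂ // v ≠ 0})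
    (h : Fin.removeNth i (v : Fin (n + 1 + 1) → ℂ) ≠ 0) :
    scaleAt i t (mk v) = mk ⟨update (v : Fin (n + 1 + 1) → ℂ) i (t * (v : Fin (n + 1 + 1) → ℂ) i),
      update_ne_zero_of_removeNth_ne_zero i _ _ h⟩ :=
  dif_neg _

/-- Scaling the `i`-th coordinate preserves the punctured projective space `ℂℙⁿ⁺¹ ∖ {center i}`. [folklore] -/
theorem offCenter_scaleAt (i : Fin (n + 1 + 1)) (t : ℂ) {p : ComplexProjectiveSpace (n + 1)}
    (hp : OffCenter i p) : OffCenter i (scaleAt i t p) := by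
  induction p using ind with
  | h v =>
    rw [offCenter_mk] at hp
    rw [scaleAt_mk i t v hp, offCenter_mk]
    simpa using hp

/-- At `t = 0` the scaling map is the projection from the centre followed by the hyperplane
embedding, `[v] ↦ [v₀ : ⋯ : 0 : ⋯ : vₙ₊₁]`. [folklore] -/
theorem scaleAt_zero (i : Fin (n + 1 + 1)) {p : ComplexProjectiveSpace (n + 1)} (hp : OffCenter i p) :
    scaleAt i 0 p = hyperplaneEmb i (dropAt i p) := by
  induction p using ind with
  | h v =>
    rw [offCenter_mk] at hp
    rw [scaleAt_mk i 0 v hp, dropAt_mk i v hp, hyperplaneEmb_mk]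
    congr 1
    refine Subtype.ext ?_
    simp only [zero_mul, coe_padAt]
    exact (Fin.insertNth_removeNth i 0 _).symm

/-- At `t = 1` the scaling map is the identity. [folklore] -/
theorem scaleAt_one (i : Fin (n + 1 + 1)) {p : ComplexProjectiveSpace (n + 1)} (hp : OffCenter i p) :
    scaleAt i 1 p = p := by
  induction p using ind with
  | h v =>
    rw [offCenter_mk] at hp
    rw [scaleAt_mk i 1 v hp]
    congr 1
    exact Subtype.ext (by simp)

/-- The restriction of the quotient map `mk` over the punctured projective space is an open
quotient map. [folklore] -/
theorem isOpenQuotientMap_restrictPreimage_mk (s : Set (ComplexProjectiveSpace (n + 1))) :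
    IsOpenQuotientMap (s.restrictPreimage (mk : _ → ComplexProjectiveSpace (n + 1))) :=
  ⟨mk_surjective.restrictPreimage s, continuous_mk.restrictPreimage, isOpenMap_mk.restrictPreimage s⟩

/-- Joint continuity of `(t, p) ↦ scaleAt i t p` on `ℂ × (ℂℙⁿ⁺¹ ∖ {center i})`. [folklore] -/
theorem continuous_scaleAt_uncurry (i : Fin (n + 1 + 1)) :
    Continuous fun x : ℂ × ↥({center i}ᶜ : Set (ComplexProjectiveSpace (n + 1))) ↦ scaleAt i x.1 x.2 := by
  set s : Set (ComplexProjectiveSpace (n + 1)) := {center i}ᶜ with hs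
  have hΦ : IsOpenQuotientMap (Prod.map (@id ℂ) (s.restrictPreimage (mk : _ → ComplexProjectiveSpace (n + 1)))) :=
    IsOpenQuotientMap.id.prodMap (isOpenQuotientMap_restrictPreimage_mk s)
  rw [← hΦ.continuous_comp_iff]
  have hmem : ∀ v : ↥(mk ⁻¹' s),
      Fin.removeNth i ((v : {v : Fin (n + 1 + 1) → ℂ // v ≠ 0}) : Fin (n + 1 + 1) → ℂ) ≠ 0 :=
    fun v ↦ (mem_compl_center_iff i _).1 v.2
  have hg : Continuous fun x : ℂ × ↥(mk ⁻¹' s) ↦ mk (n := n + 1)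
      ⟨update ((x.2 : {v : Fin (n + 1 + 1) → ℂ // v ≠ 0}) : Fin (n + 1 + 1) → ℂ) i
        (x.1 * ((x.2 : {v : Fin (n + 1 + 1) → ℂ // v ≠ 0}) : Fin (n + 1 + 1) → ℂ) i),
        update_ne_zero_of_removeNth_ne_zero i _ _ (hmem x.2)⟩ := by
    refine continuous_mk.comp (Continuous.subtype_mk ?_ _)
    have hv : Continuous fun x : ℂ × ↥(mk ⁻¹' s) ↦
        ((x.2 : {v : Fin (n + 1 + 1) → ℂ // v ≠ 0}) : Fin (n + 1 + 1) → ℂ) :=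
      continuous_subtype_val.comp (continuous_subtype_val.comp continuous_snd)
    exact hv.update i (continuous_fst.mul ((continuous_apply i).comp hv))
  convert hg using 1
  funext x
  exact scaleAt_mk i x.1 _ (hmem x.2)

/-- The straight-line homotopy from the projection-then-inclusion `[v] ↦ [v₀ : ⋯ : 0 : ⋯ : vₙ₊₁]` to
the identity of the punctured projective space `ℂℙⁿ⁺¹ ∖ {center i}`, `(t, [v]) ↦ [⋯ : t vᵢ : ⋯]`
(Hatcher, *Algebraic Topology* (2002), Example 0.6: `ℂPⁿ⁺¹ ∖ {pt}` deformation retracts onto `ℂPⁿ`). [folklore] -/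
def scaleHomotopy (i : Fin (n + 1 + 1)) :
    ContinuousMap.Homotopy ((hyperplaneEmbMap i).comp (dropAtMap i))
      (ContinuousMap.id ↥({center i}ᶜ : Set (ComplexProjectiveSpace (n + 1)))) where
  toFun x := ⟨scaleAt i (x.1 : ℝ) x.2.1,
    (mem_compl_center_iff i _).2 (offCenter_scaleAt i _ ((mem_compl_center_iff i _).1 x.2.2))⟩
  continuous_toFun := by
    refine Continuous.subtype_mk ?_ _
    exact (continuous_scaleAt_uncurry i).comp
      ((Complex.continuous_ofReal.comp (continuous_induced_dom.comp continuous_fst)).prodMk continuous_snd)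
  map_zero_left x := by
    refine Subtype.ext ?_
    change scaleAt i ((0 : ℝ) : ℂ) x.1 = hyperplaneEmb i (dropAt i x.1)
    rw [Complex.ofReal_zero]
    exact scaleAt_zero i ((mem_compl_center_iff i _).1 x.2)
  map_one_left x := by
    refine Subtype.ext ?_
    change scaleAt i ((1 : ℝ) : ℂ) x.1 = x.1
    rw [Complex.ofReal_one]
    exact scaleAt_one i ((mem_compl_center_iff i _).1 x.2)

/-- **`ℂℙⁿ⁺¹` minus a point is homotopy equivalent to `ℂℙⁿ`**: the punctured projective space
`ℂℙⁿ⁺¹ ∖ {center i}` deformation retracts onto the hyperplane `{zᵢ = 0} ≅ ℂℙⁿ`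
(Hatcher, *Algebraic Topology* (2002), Example 0.6 and the cell structure of `ℂPⁿ`, p. 7). [folklore] -/
def homotopyEquivComplCenter (i : Fin (n + 1 + 1)) :
    ContinuousMap.HomotopyEquiv (ComplexProjectiveSpace n) ↥({center i}ᶜ : Set (ComplexProjectiveSpace (n + 1))) where
  toFun := hyperplaneEmbMap i
  invFun := dropAtMap i
  left_inv := by
    have h : (dropAtMap i).comp (hyperplaneEmbMap i) = ContinuousMap.id (ComplexProjectiveSpace n) := by
      ext q : 1
      exact dropAt_hyperplaneEmb i q
    rw [h]
  right_inv := ⟨scaleHomotopy i⟩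

end ComplexProjectiveSpace

end Literature.Topology.FourManifolds

/-! ### A Mayer–Vietoris isomorphism criterion -/

namespace Literature.AlgebraicTopology.SingularHomology

open CategoryTheory Limits

universe u v

variable (R : Type v) [CommRing R] (M : Type v) [AddCommGroup M] [Module R M]
variable {X : Type u} [TopologicalSpace X]

/-- **Mayer–Vietoris isomorphism criterion.** Let `interior U ∪ interior V = X`. If
`Hₙ₊₁(U ∩ V; M) = 0`, `Hₙ(U ∩ V; M) = 0` and `Hₙ₊₁(V; M) = 0`, then the inclusion `U ↪ X` induces an
isomorphism `Hₙ₊₁(U; M) ≅ Hₙ₊₁(X; M)`: in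
`Hₙ₊₁(U ∩ V) ⟶φ Hₙ₊₁(U) ⊞ Hₙ₊₁(V) ⟶ψ Hₙ₊₁(X) ⟶δ Hₙ(U ∩ V)` the outer terms vanish, so `ψ` is an
isomorphism, and `Hₙ₊₁(V) = 0` (Hatcher, *Algebraic Topology* (2002), §2.2 p. 149). From the proved
exactness of the Mayer–Vietoris sequence (`mayerVietoris.exact₁_holds`, `exact₂_holds`) and proved
excision (`relativeSingularHomology.isIso_map_of_interior_union_interior_holds`). [cite: HatcherAT2002, §2.2 p. 149] -/
theorem mayerVietoris.isIso_map_subsetIncl_of_isZero (U V : Set X)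
    (hUV : interior U ∪ interior V = Set.univ) (n : ℕ)
    (h₁ : IsZero (singularHomology R M ↥(U ∩ V) (n + 1)))
    (h₀ : IsZero (singularHomology R M ↥(U ∩ V) n))
    (hV : IsZero (singularHomology R M V (n + 1))) :
    IsIso (singularHomology.map R M (subsetIncl U) (n + 1)) := by
  have hexc := relativeSingularHomology.isIso_map_of_interior_union_interior_holds R M X
  -- `ψ` is a monomorphism: `φ = 0`
  have hφ : mayerVietoris.φ R M U V (n + 1) = 0 := h₁.eq_of_src _ _
  haveI hmono : Mono (mayerVietoris.ψ R M U V (n + 1)) :=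
    (mayerVietoris.exact₁_holds R M U V hUV (n + 1)).mono_g hφ
  -- `ψ` is an epimorphism: `δ = 0`
  have hδ : mayerVietoris.δ R M U V hexc hUV n = 0 := h₀.eq_of_tgt _ _
  haveI hepi : Epi (mayerVietoris.ψ R M U V (n + 1)) :=
    (mayerVietoris.exact₂_holds R M U V hexc hUV n).epi_f hδ
  haveI : IsIso (mayerVietoris.ψ R M U V (n + 1)) := isIso_of_mono_of_epi _
  -- `inl : Hₙ₊₁(U) ⟶ Hₙ₊₁(U) ⊞ Hₙ₊₁(V)` is an isomorphism since `Hₙ₊₁(V) = 0`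
  haveI := isIso_biprod_fst_of_isZero (A := singularHomology R M U (n + 1)) hV
  haveI : IsIso ((biprod.inl : singularHomology R M U (n + 1) ⟶
      singularHomology R M U (n + 1) ⊞ singularHomology R M V (n + 1)) ≫ biprod.fst) := by
    rw [biprod.inl_fst]
    infer_instance
  haveI : IsIso (biprod.inl : singularHomology R M U (n + 1) ⟶
      singularHomology R M U (n + 1) ⊞ singularHomology R M V (n + 1)) :=
    IsIso.of_isIso_comp_right biprod.inl biprod.fst
  have hfac : singularHomology.map R M (subsetIncl U) (n + 1) =
      biprod.inl ≫ mayerVietoris.ψ R M U V (n + 1) := (biprod.inl_desc _ _).symm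
  rw [hfac]
  infer_instance

end Literature.AlgebraicTopology.SingularHomology

/-! ### The second homology of the complex projective plane -/

namespace Literature.Topology.FourManifolds

open CategoryTheory Limits
open Literature.AlgebraicTopology.SingularHomology ComplexProjectiveSpace

universe v

variable (R : Type v) [CommRing R] (M : Type v) [AddCommGroup M] [Module R M]

namespace ComplexProjectivePlane

/-- The inverse of the affine chart `{z₂ ≠ 0}` of `ℂℙ²`, an open embedding `ℝ⁴ → ℂℙ²` centred at
`[0 : 0 : 1]`. [folklore] -/
def chartEmb : EuclideanSpace ℝ (Fin (3 + 1)) → ComplexProjectivePlane :=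
  fun x ↦ (ComplexProjectiveSpace.affineChart (n := 2) 2).symm x

/-- The inverse affine chart `ℝ⁴ → ℂℙ²` is an open embedding (its target is the whole model space). [folklore] -/
theorem isOpenEmbedding_chartEmb : IsOpenEmbedding chartEmb :=
  (ComplexProjectiveSpace.affineChart (n := 2) 2).symm.to_isOpenEmbedding (by simp)

/-- The inverse affine chart `{z₂ ≠ 0}` is centred at `[0 : 0 : 1] = center 2`. [folklore] -/
theorem chartEmb_zero : chartEmb 0 = center (n := 1) 2 :=
  affineChart_symm_zero (n := 1) 2

/-- `Hₖ` of the punctured chart `{z₂ ≠ 0} ∖ {[0:0:1]} ≅ ℝ⁴ ∖ {0} ≃ S³` vanishes for `k ≠ 0, 3`. [folklore] -/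
theorem isZero_singularHomology_compl_inter_range {k : ℕ} (hk : k ≠ 0) (hk3 : k ≠ 3) :
    IsZero (singularHomology R M ↥(({chartEmb 0}ᶜ : Set ComplexProjectivePlane) ∩ Set.range chartEmb) k) := by
  haveI := isIso_singularHomology_map_sphereToComplZero R M 3 k
  exact (isZero_singularHomology_unitSphere R M 3 k hk hk3).of_iso
    (asIso (singularHomology.map R M (sphereToComplZero 3) k) ≪≫
      singularHomology.mapIso R M (complZeroHomeomorphInter isOpenEmbedding_chartEmb.isEmbedding) k).symm

/-- **Mayer–Vietoris for `ℂℙ² = (ℂℙ² ∖ {[0:0:1]}) ∪ {z₂ ≠ 0}`**: the inclusion of the punctured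
plane induces an isomorphism on `H₂` (the chart is contractible and the intersection is
`ℝ⁴ ∖ {0} ≃ S³`, with `H₁ = H₂ = 0`; Hatcher 2002, §2.2 p. 149). [cite: HatcherAT2002, §2.2 p. 149] -/
theorem isIso_singularHomology_map_subsetIncl_compl_center :
    IsIso (singularHomology.map R M
      (subsetIncl ({center (n := 1) 2}ᶜ : Set ComplexProjectivePlane)) 2) := by
  rw [← chartEmb_zero]
  refine mayerVietoris.isIso_map_subsetIncl_of_isZero R M _ (Set.range chartEmb)
    (interior_compl_union_interior_range isOpenEmbedding_chartEmb) 1 ?_ ?_ ?_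
  · exact isZero_singularHomology_compl_inter_range R M two_ne_zero (by norm_num)
  · exact isZero_singularHomology_compl_inter_range R M one_ne_zero (by norm_num)
  · exact isZero_singularHomology_range R M isOpenEmbedding_chartEmb two_ne_zero

/-- `ℂℙ¹ ≅ S²` as topological spaces (the Riemann sphere), from the tree's diffeomorphism
`nonempty_diffeomorph_complexProjectiveSpace_one_sphere_holds`. [folklore] -/
def projectiveLineHomeomorphSphere :
    ComplexProjectiveSpace 1 ≃ₜ ↥(unitSphere (2 + 1)) :=
  (Classical.choice nonempty_diffeomorph_complexProjectiveSpace_one_sphere_holds).toHomeomorph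

/-- **`H₂(ℂℙ²; M) ≅ M`** (Hatcher, *Algebraic Topology* (2002), §2.2 p. 140: `Hᵢ(ℂPⁿ) ≅ ℤ` for
`i` even `≤ 2n`, `0` otherwise; here in degree `2`, for every coefficient module): Mayer–Vietoris
reduces to the punctured plane, which deformation retracts onto `ℂℙ¹ ≅ S²`, and `H₂(S²; M) ≅ M`.
[cite: HatcherAT2002, §2.2 pp. 140, 149 and Cor. 2.14] -/
def singularHomologyTwoIso : singularHomology R M ComplexProjectivePlane 2 ≅ ModuleCat.of R M :=
  haveI := isIso_singularHomology_map_subsetIncl_compl_center R M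
  (asIso (singularHomology.map R M
      (subsetIncl ({center (n := 1) 2}ᶜ : Set ComplexProjectivePlane)) 2)).symm ≪≫
    (singularHomology.isoOfHomotopyEquiv R M (homotopyEquivComplCenter (n := 1) 2) 2).symm ≪≫
      singularHomology.mapIso R M projectiveLineHomeomorphSphere 2 ≪≫
        singularHomologyUnitSphereIso R M 2 (by norm_num)

/-! ### `H²(ℂℙ²; ℤ)/T ≅ ℤ` -/

/-- `ℂℙ²` is simply connected (tree theorem `simplyConnectedSpace_complexProjectivePlane_holds`),
as an instance for this file. -/
instance instSimplyConnectedSpace : SimplyConnectedSpace ComplexProjectivePlane :=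
  simplyConnectedSpace_complexProjectivePlane_holds

/-- `H₁(ℂℙ²; M) = 0` (simply connected; Hatcher 2002, Thm. 2A.1). [cite: HatcherAT2002, Thm. 2A.1] -/
theorem isZero_singularHomology_one : IsZero (singularHomology R M ComplexProjectivePlane 1) :=
  isZero_singularHomology_one_of_simplyConnectedSpace R M

/-- **`H²(ℂℙ²; ℤ) ≃ ℤ`**: the Kronecker map `H² → Hom(H₂, ℤ)` is bijective since `H₁(ℂℙ²) = 0`
(universal coefficients, Hatcher 2002, Thm. 3.2), and `H₂(ℂℙ²; ℤ) ≅ ℤ`. [cite: HatcherAT2002, §3.1 Thm. 3.2] -/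
def singularCohomologyTwoLinearEquivInt : singularCohomology ℤ ℤ ComplexProjectivePlane 2 ≃ₗ[ℤ] ℤ :=
  (LinearEquiv.ofBijective (kroneckerPairing ℤ ℤ ComplexProjectivePlane 2)
      (kroneckerPairing_bijective_of_isZero ℤ ComplexProjectivePlane 1
        (isZero_singularHomology_one ℤ ℤ))).trans
    (((singularHomologyTwoIso ℤ ℤ).toLinearEquiv.symm.dualMap).trans
      (LinearMap.ringLmapEquivSelf ℤ ℤ ℤ))

/-- `H²(ℂℙ²; ℤ)` is torsion free (`H₁ = 0`; Hatcher 2002, Cor. 3.3). [cite: HatcherAT2002, §3.1 Cor. 3.3] -/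
theorem torsion_singularCohomology_two_eq_bot :
    Submodule.torsion ℤ (singularCohomology ℤ ℤ ComplexProjectivePlane 2) = ⊥ :=
  torsion_singularCohomology_eq_bot_of_isZero ℤ ComplexProjectivePlane 1 (isZero_singularHomology_one ℤ ℤ)

/-- **`H²(ℂℙ²; ℤ)/T ≃ ℤ`** (Hatcher 2002, §3.3 p. 250 with Thm. 3.2 / Cor. 3.3: no torsion to factor
out, and `H² ≅ Hom(H₂, ℤ) ≅ ℤ`). [cite: HatcherAT2002, §3.1 Thm. 3.2 and §3.3 p. 250] -/
def freeCohomologyTwoLinearEquivInt : freeCohomology ℤ ComplexProjectivePlane 2 ≃ₗ[ℤ] ℤ :=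
  (Submodule.quotEquivOfEqBot _ torsion_singularCohomology_two_eq_bot).trans
    singularCohomologyTwoLinearEquivInt

/-- **`b₂(ℂℙ²) = 1`**: the lattice `H²(ℂℙ²; ℤ)/T` has rank one (Milnor–Stasheff 1974, Thm. 14.10 /
Hatcher 2002, Thm. 3.19: `H²(ℂP²; ℤ) ≅ ℤ`). [cite: HatcherAT2002, §3.1 Thm. 3.2 and §3.3 p. 250] -/
theorem finrank_freeCohomology_two :
    Module.finrank ℤ (freeCohomology ℤ ComplexProjectivePlane 2) = 1 := by
  rw [freeCohomologyTwoLinearEquivInt.finrank_eq, Module.finrank_self]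

end ComplexProjectivePlane

/-! ### The signature of `ℂℙ²` -/

/-- **`ℂℙ²` carries a `ℤ`-orientation of signature `1`, given Poincaré duality for `ℂℙ²`**
(Thom 1954, Thm IV.13 and p. 82: "pour `PC(2)`, pour lequel `τ = 1`"; Milnor–Stasheff 1974,
Thm. 14.10).  Proof: `ℂℙ²` is simply connected, hence `ℤ`-orientable
(`isOrientableOver_int_of_simplyConnectedSpace_holds`); its cup form on the rank-one lattice
`H²(ℂℙ²; ℤ)/T ≅ ℤ` (`finrank_freeCohomology_two`) is unimodular by Poincaré duality (the hypothesis
`hD`, Hatcher Thm. 3.30, through `isPerfPair_cupPairingModTorsion_of_poincareDuality`) and symmetric,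
so `b₂⁺ + b₂⁻ = 1` (`sigPos_add_sigNeg_intersectionForm_of_isPerfPair`) and `σ = ±1`; reversing the
orientation if necessary (`signature_neg_holds`) gives `σ = 1`. [cite: ThomCMH1954, Thm IV.13 and p. 82] -/
theorem exists_signature_complexProjectivePlane_eq_one_of_poincareDuality
    (hD : ∀ μ : HomologicalOrientation ℤ ComplexProjectivePlane 4,
      bijective_poincareDualityMap μ two_add_two_eq_four) :
    exists_signature_complexProjectivePlane_eq_one := by
  -- a `ℤ`-orientation exists
  obtain ⟨μ⟩ : Nonempty (HomologicalOrientation ℤ ComplexProjectivePlane 4) :=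
    isOrientableOver_int_of_simplyConnectedSpace_holds ComplexProjectivePlane (n := 4)
  -- `b₂⁺ + b₂⁻ = b₂ = 1`
  have hF : finite_singularCohomology_of_compactSpace ℤ ComplexProjectivePlane 4 2 :=
    finite_singularCohomology_of_compactSpace_of_isPrincipalIdealRing ℤ ComplexProjectivePlane 4 2
  have hK : LinearMap.ker (kroneckerPairing ℤ ℤ ComplexProjectivePlane 2) ≤
      Submodule.torsion ℤ (singularCohomology ℤ ℤ ComplexProjectivePlane 2) := by
    rw [LinearMap.ker_eq_bot.2 (kroneckerPairing_bijective_of_isZero ℤ ComplexProjectivePlane 1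
      (ComplexProjectivePlane.isZero_singularHomology_one ℤ ℤ)).1]
    exact bot_le
  have hP : isPerfPair_cupPairingModTorsion μ two_add_two_eq_four :=
    isPerfPair_cupPairingModTorsion_of_poincareDuality μ _ (hD μ) (kroneckerMap_surjective_holds ℤ ComplexProjectivePlane 2) hK hF
  have hsum := sigPos_add_sigNeg_intersectionForm_of_isPerfPair even_two two_add_two_eq_four μ hP
    (cupProduct_gradedComm_holds ℤ ComplexProjectivePlane) hF
  unfold sigPos_add_sigNeg_intersectionForm at hsum
  rw [ComplexProjectivePlane.finrank_freeCohomology_two] at hsum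
  -- hence `σ(ℂℙ², μ) = ±1`; flip the orientation if it is `-1`
  by_cases h1 : sigPos (intersectionForm two_add_two_eq_four μ).toQuadraticMap = 1
  · refine ⟨μ, ?_⟩
    change ((sigPos (intersectionForm two_add_two_eq_four μ).toQuadraticMap : ℕ) : ℤ) -
      (sigNeg (intersectionForm two_add_two_eq_four μ).toQuadraticMap : ℕ) = 1
    omega
  · refine ⟨-μ, ?_⟩
    rw [HomologicalOrientation.signature_neg_holds μ]
    change -(((sigPos (intersectionForm two_add_two_eq_four μ).toQuadraticMap : ℕ) : ℤ) -
      (sigNeg (intersectionForm two_add_two_eq_four μ).toQuadraticMap : ℕ)) = 1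
    omega

/-- **Discharge of `exists_signature_complexProjectivePlane_eq_one` (spc4.S36; Thom 1954,
Thm IV.13 and p. 82: the generator `PC(2)` of `Ω⁴ ≅ ℤ` has `τ = 1`)**: the complex projective plane
carries a `ℤ`-orientation of signature `1`.  From
`exists_signature_complexProjectivePlane_eq_one_of_poincareDuality` and the tree's proof of
Poincaré duality for closed oriented manifolds (`poincare_duality`, Hatcher Thm. 3.30).
[cite: ThomCMH1954, Thm IV.13 and p. 82] -/
theorem exists_signature_complexProjectivePlane_eq_one_holds :
    exists_signature_complexProjectivePlane_eq_one :=
  exists_signature_complexProjectivePlane_eq_one_of_poincareDuality fun μ ↦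
    poincare_duality μ two_add_two_eq_four

end Literature.Topology.FourManifolds

end
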